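import Mathlib
import Literature.NumberTheory.Automorphic.CDTTheorem712ConductorStepProofs
import Literature.NumberTheory.EllipticCurves.SzpiroFreyCurveProofs
import HarnessLib

/-!
# CyclicIsogenyDegreeTwenty

Topic `Literature/NumberTheory/EllipticCurves`. Named literature fact(s) relocated by the gate from `Summits/ABC/ABC/Theorems/DefiniteXiFreyModularitySketch.lean`
(accept-time relocation of `[cite]`d propositions written inline in a Summits proposal; human ruling 2026-08-15).
Sources: Kenku1982.

* `Literature.NumberTheory.EllipticCurves.isogeny_isCyclic_degree_ne_twenty`
-/

namespace Literature.NumberTheory.EllipticCurves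

open scoped MatrixGroups
open Literature.NumberTheory.EllipticCurves
open Literature.NumberTheory.Automorphic
open Literature.NumberTheory.Automorphic.BCDT
open Literature.NumberTheory.GaloisRepresentations
open WeierstrassCurve

/-- **No rational cyclic `20`-isogeny** (Kenku 1982, Thm. 1, completing Mazur 1978: the integers `N`
for which some elliptic curve over `ℚ` admits a `ℚ`-rational cyclic isogeny of degree `N` —
equivalently for which `X₀(N)(ℚ)` has a non-cuspidal point — are `1 ≤ N ≤ 19` and
`N ∈ {21, 25, 27, 37, 43, 67, 163}`; `N = 20` is absent, the genus-one curve `X₀(20)` having exactly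
six rational points, all cusps: Ligozat 1975).  In the tree's vocabulary (`WeierstrassCurve.Isogeny`,
`Isogeny.IsCyclic`, `Isogeny.degree = #ker`, characteristic `0`): every cyclic `ℚ`-isogeny between
elliptic curves over `ℚ` has degree `≠ 20`.  This is the case `N = 20` of the classification recorded as
`Literature.NumberTheory.EllipticCurves.mazurKenku_exists_cyclic_isogeny` (there in existential form);
it is the only modular-curve input of the line `Sketch` of crux stmt-ABC-11340 (hypothesis `h20` of
`freyModularity_of_CDT721_CDT722_switch_degreeNeTwenty`). Not in Mathlib (no modular curves).
-- TODO(general form): Kenku's full list, i.e. `φ.IsCyclic → φ.degree ∈ kenkuDegrees` for every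
-- cyclic `ℚ`-isogeny `φ` between elliptic curves over `ℚ`.
[cite: Kenku1982, Thm. 1] [file NumberTheory/EllipticCurves/RationalIsogenyDegrees] -/
def isogeny_isCyclic_degree_ne_twenty : Prop :=
  ∀ (W₁ W₂ : WeierstrassCurve ℚ) [WeierstrassCurve.IsElliptic W₁] [WeierstrassCurve.IsElliptic W₂]
    (φ : WeierstrassCurve.Isogeny W₁ W₂),
    WeierstrassCurve.Isogeny.IsCyclic φ → WeierstrassCurve.Isogeny.degree φ ≠ 20

end Literature.NumberTheory.EllipticCurves
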